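import Literature.Computability.MetaComplexity.KEvaluations
import Literature.Computability.MetaComplexity.FregeBounded
import Literature.Computability.MetaComplexity.FregeMod
import Literature.Computability.MetaComplexity.FpLinearSystems
import Literature.Computability.MetaComplexity.ScopeExpansion
import HarnessLib

/-!
# The low-depth slices of `LinearGeneratorModPFregeHard` are vacuous (`d ≤ 4`)

Support file for item `stmt-PneNP-11444` (`LinearGeneratorModPFregeHard`, route
`ExpanderLinearGenerators`), complementing the calibration file
`ExpanderLinearGeneratorsLinearGeneratorModPFregeHardCalibration.lean` (proofs of the target exist
from depth `30` on).  Here: NO `textbookFrege(MOD_a)` proof of depth `≤ 4` of the route target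
`ofPropForm (¬ ofCNF (sumEncoding 1 E))` exists under the route's hypotheses, so the slices
`d ≤ 4` of the rung hold for the trivial reason that their `π`-quantifier is empty.

* `disj_neg_mem_of_neg_mem` — in a hypothesis-free `textbookFrege(MOD_a)` derivation a line
  `¬Y` (`Y` neither `⊥` nor a `MOD` gate) can only be the conclusion of CONTRACTION, so
  `¬Y ∨ ¬Y` is an (earlier) line; hence (`altDepth_succ_le_of_isModDepthProofOf`) every
  depth-`d` proof of `¬Y` has `d ≥ altDepth(¬Y) + 1`.
* `four_le_altDepth_neg_ofCNF` — `altDepth (¬ ofCNF φ) ≥ 4` as soon as some clause of `φ`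
  contains a negative literal (`≥ 3` for a nonempty clause).
* `linearGeneratorModPFregeHard_of_depth_le_four` — the rung's statement with the extra
  hypothesis `d ≤ 4`, proved outright (under the route hypotheses with `n ≥ 1` every clause of
  `sumEncoding 1 E` is nonempty — boundary expansion forces nonempty supports — and, the CNF
  being unsatisfiable, some clause carries a negative literal; so the target has depth `4` and
  any proof of it a line of depth `5`).

Sources: S. Buss et al., Comput. Complexity 6 (1996/97), Def. 1.1 (`F_d(MOD_a)`: all lines of
depth `≤ d`); J. R. Shoenfield, *Mathematical Logic* (1967), §2.6 (the rules of the system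
`textbookFrege`); J. Krajíček, *Proof Complexity* (CUP 2019), §13.3 (boundary expanders).
The observations are folklore ("a tautology of depth `> d` has no depth-`d` proof, being itself
a line", `FregeMod.lean`, design notes).
-/

set_option linter.dupNamespace false -- `Summit.PneNP.PneNP.…`: summit = sub-problem (D-0017)

namespace Summit.PneNP.PneNP.Theorems

open Literature.Computability.Complexity Literature.Computability.Complexity.PropForm
open Literature.Computability.MetaComplexity
open Literature.Computability.MetaComplexity.KEval (litForm clauseForm clauseForm_cons ofCNF_cons)

/-! ### A negation is inferred by contraction only -/

/-- **How a negation enters a `textbookFrege(MOD_a)` proof.** In a derivation from no hypotheses,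
a line `¬Y` with `Y` neither the constant `⊥` nor a `MOD` gate is the conclusion of the
contraction rule `A ∨ A ⊢ A` (no other rule or axiom of `textbookFrege(MOD_a)` concludes a
negation of that shape), so `¬Y ∨ ¬Y` is also a line. [Shoenfield 1967, §2.6 (the rules);
Buss et al. 1997, Def. 1.1 (the `MOD_a` axioms)] [folklore] -/
theorem disj_neg_mem_of_neg_mem {a : ℕ} {π : List (PropFormMod a ℕ)}
    (hπ : textbookFrege.IsModDerivation ∅ π) {Y : PropFormMod a ℕ}
    (hY : Y ≠ PropFormMod.const false)
    (hY' : ∀ (k : ℕ) (i : ZMod a) (args : Fin k → PropFormMod a ℕ), Y ≠ PropFormMod.modc i args)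
    (hmem : PropFormMod.neg Y ∈ π) : PropFormMod.disj (PropFormMod.neg Y) (PropFormMod.neg Y) ∈ π := by
  obtain ⟨k, hk, hkY⟩ := List.getElem_of_mem hmem
  rcases hπ k hk with h | h | ⟨r, hr, σ, hconc, hprem⟩
  · exact absurd h (Set.notMem_empty _)
  · rw [hkY] at h
    rcases h with h | ⟨i, -, h⟩ | ⟨i, k', ψ, φ, h⟩
    · exact absurd h (by simp)
    · simp only [PropFormMod.neg.injEq] at h
      exact absurd h (hY' _ _ _)
    · simp [PropFormMod.biimp] at h
  · rw [hkY] at hconc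
    have hprem' : ∀ q ∈ r.premises, (PropFormMod.ofPropForm q).subst σ ∈ π :=
      fun q hq => List.mem_of_mem_take (hprem q hq)
    simp only [textbookFrege, List.mem_cons, List.not_mem_nil, or_false] at hr
    rcases hr with rfl | rfl | rfl | rfl | rfl | rfl | rfl | rfl | rfl
    · simp [PropFormMod.ofPropForm, PropFormMod.subst] at hconc
    · simp [PropFormMod.ofPropForm, PropFormMod.subst] at hconc
    · -- contraction `A ∨ A ⊢ A`
      simp only [PropFormMod.ofPropForm, PropFormMod.subst] at hconc
      have := hprem' _ (List.mem_singleton.2 rfl)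
      simpa [PropFormMod.ofPropForm, PropFormMod.subst, hconc] using this
    · simp [PropFormMod.ofPropForm, PropFormMod.subst] at hconc
    · simp [PropFormMod.ofPropForm, PropFormMod.subst] at hconc
    · simp [PropFormMod.ofPropForm, PropFormMod.subst] at hconc
    · simp [PropFormMod.ofPropForm, PropFormMod.subst] at hconc
    · simp [PropFormMod.ofPropForm, PropFormMod.subst] at hconc
    · simp only [PropFormMod.ofPropForm, PropFormMod.subst, PropFormMod.neg.injEq] at hconc
      exact absurd hconc.symm hY

/-- `¬Y ∨ ¬Y` is one level deeper than `¬Y`. [Buss et al. 1997, Def. 1.1 (depth)] [folklore] -/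
theorem altDepth_disj_neg_neg {a : ℕ} (Y : PropFormMod a ℕ) :
    (PropFormMod.disj (PropFormMod.neg Y) (PropFormMod.neg Y)).altDepth =
      (PropFormMod.neg Y).altDepth + 1 := by
  simp [PropFormMod.altDepth, PropFormMod.altDepthAux]

/-- **Depth of a proof of a negation.** Every depth-`d` `textbookFrege(MOD_a)` proof of `¬Y`
(`Y` neither `⊥` nor a `MOD` gate) satisfies `altDepth(¬Y) + 1 ≤ d`: it contains the line
`¬Y ∨ ¬Y`. [Buss et al. 1997, Def. 1.1] [folklore] -/
theorem altDepth_succ_le_of_isModDepthProofOf {a d : ℕ} {π : List (PropFormMod a ℕ)}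
    {Y : PropFormMod a ℕ} (hY : Y ≠ PropFormMod.const false)
    (hY' : ∀ (k : ℕ) (i : ZMod a) (args : Fin k → PropFormMod a ℕ), Y ≠ PropFormMod.modc i args)
    (h : textbookFrege.IsModDepthProofOf d π (PropFormMod.neg Y)) :
    (PropFormMod.neg Y).altDepth + 1 ≤ d := by
  have h2 := disj_neg_mem_of_neg_mem h.1.1 hY hY' (List.mem_of_getLast? h.1.2)
  have h3 := h.2 _ h2
  rw [altDepth_disj_neg_neg] at h3
  exact h3

/-! ### Depth of the target `¬ ofCNF φ` from below -/

/-- A clause formula sits inside the `∧`-block of `ofCNF φ`. [folklore] -/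
theorem altDepthAux_two_clauseForm_le_ofCNF {φ : CNF ℕ} {c : Clause ℕ} (hc : c ∈ φ) :
    altDepthAux 2 (clauseForm c) ≤ altDepthAux 2 (PropForm.ofCNF φ) := by
  induction φ with
  | nil => simp at hc
  | cons c₀ φ ih =>
    rw [ofCNF_cons]
    simp only [altDepthAux, if_true, add_zero]
    rcases List.mem_cons.1 hc with rfl | hc
    · exact le_max_left _ _
    · exact (ih hc).trans (le_max_right _ _)

/-- For a nonempty CNF, `altDepth (¬ ofCNF φ) = altDepthAux 2 (ofCNF φ) + 2`. [folklore] -/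
theorem altDepth_neg_ofCNF_eq {φ : CNF ℕ} (hφ : φ ≠ []) :
    (PropForm.neg (PropForm.ofCNF φ)).altDepth = altDepthAux 2 (PropForm.ofCNF φ) + 2 := by
  obtain ⟨c, φ, rfl⟩ := List.exists_cons_of_ne_nil hφ
  rw [ofCNF_cons]
  simp [altDepth, altDepthAux]

/-- A literal formula sits inside the `∨`-block of its clause formula. [folklore] -/
theorem altDepthAux_three_litForm_le_clauseForm {c : Clause ℕ} {l : Literal ℕ} (hl : l ∈ c) :
    altDepthAux 3 (litForm l) ≤ altDepthAux 3 (clauseForm c) := by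
  induction c with
  | nil => simp at hl
  | cons l₀ c ih =>
    rw [clauseForm_cons]
    simp only [altDepthAux, if_true, add_zero]
    rcases List.mem_cons.1 hl with rfl | hl
    · exact le_max_left _ _
    · exact (ih hl).trans (le_max_right _ _)

/-- For a nonempty clause, `altDepthAux 2 (clauseForm c) = altDepthAux 3 (clauseForm c) + 1`.
[folklore] -/
theorem altDepthAux_two_clauseForm_eq {c : Clause ℕ} (hc : c ≠ []) :
    altDepthAux 2 (clauseForm c) = altDepthAux 3 (clauseForm c) + 1 := by
  obtain ⟨l, c, rfl⟩ := List.exists_cons_of_ne_nil hc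
  rw [clauseForm_cons]
  simp [altDepthAux]

/-- **A nonempty clause forces depth `≥ 3`.** [Krajíček 1995, §4.3] [folklore] -/
theorem three_le_altDepth_neg_ofCNF {φ : CNF ℕ} {c : Clause ℕ} (hc : c ∈ φ) (hne : c ≠ []) :
    3 ≤ (PropForm.neg (PropForm.ofCNF φ)).altDepth := by
  rw [altDepth_neg_ofCNF_eq (List.ne_nil_of_mem hc)]
  have h1 := altDepthAux_two_clauseForm_le_ofCNF hc
  rw [altDepthAux_two_clauseForm_eq hne] at h1
  omega

/-- **A negative literal forces depth `4`.** If some clause of `φ` contains a negative literal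
then `altDepth (¬ ofCNF φ) ≥ 4` (blocks `¬ / ∧ / ∨ / ¬`). [Krajíček 1995, §4.3] [folklore] -/
theorem four_le_altDepth_neg_ofCNF {φ : CNF ℕ} {c : Clause ℕ} (hc : c ∈ φ) {l : Literal ℕ}
    (hl : l ∈ c) (hneg : l.2 = false) : 4 ≤ (PropForm.neg (PropForm.ofCNF φ)).altDepth := by
  rw [altDepth_neg_ofCNF_eq (List.ne_nil_of_mem hc)]
  have h1 := altDepthAux_two_clauseForm_le_ofCNF hc
  rw [altDepthAux_two_clauseForm_eq (List.ne_nil_of_mem hl)] at h1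
  have h2 := altDepthAux_three_litForm_le_clauseForm hl
  have h3 : altDepthAux 3 (litForm l) = 1 := by
    simp [litForm, hneg, altDepthAux]
  omega

/-- **No proof of depth `≤ altDepth` of the target.** A depth-`d` `textbookFrege(MOD_a)` proof of
`ofPropForm (¬ ofCNF φ)` has `d ≥ altDepth (¬ ofCNF φ) + 1`. [Buss et al. 1997, Def. 1.1]
[folklore] -/
theorem altDepth_succ_le_of_isModDepthProofOf_neg_ofCNF {a d : ℕ} {π : List (PropFormMod a ℕ)}
    {φ : CNF ℕ}
    (h : textbookFrege.IsModDepthProofOf d π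
      (PropFormMod.ofPropForm (PropForm.neg (PropForm.ofCNF φ)))) :
    (PropForm.neg (PropForm.ofCNF φ)).altDepth + 1 ≤ d := by
  have hY : (PropFormMod.ofPropForm (PropForm.ofCNF φ) : PropFormMod a ℕ) ≠ PropFormMod.const false := by
    cases φ with
    | nil => simp [PropForm.ofCNF, PropFormMod.ofPropForm]
    | cons c φ => rw [ofCNF_cons]; simp [PropFormMod.ofPropForm]
  have hY' : ∀ (k : ℕ) (i : ZMod a) (args : Fin k → PropFormMod a ℕ),
      (PropFormMod.ofPropForm (PropForm.ofCNF φ) : PropFormMod a ℕ) ≠ PropFormMod.modc i args := by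
    intro k i args
    cases φ with
    | nil => simp [PropForm.ofCNF, PropFormMod.ofPropForm]
    | cons c φ => rw [ofCNF_cons]; simp [PropFormMod.ofPropForm]
  have := altDepth_succ_le_of_isModDepthProofOf hY hY' h
  rwa [show (PropFormMod.neg (PropFormMod.ofPropForm (PropForm.ofCNF φ)) : PropFormMod a ℕ) =
      PropFormMod.ofPropForm (PropForm.neg (PropForm.ofCNF φ)) from rfl,
    PropFormMod.altDepth_ofPropForm] at this

/-! ### The clauses of `sumEncoding 1 E` under the route hypotheses -/

/-- Every clause of the sum-encoding of `E` (block size `1`) has as many literals as the support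
of its equation; in particular clauses of equations with nonempty support are nonempty.
[Beck 2017, Def. 5.6] [folklore] -/
theorem exists_length_eq_of_mem_sumEncoding {m n : ℕ} (E : Fin m → LinEqMod 2 n) {D : Clause ℕ}
    (hD : D ∈ sumEncoding 1 E) : ∃ k, D.length = (E k).supp.card := by
  simp only [sumEncoding, List.mem_flatMap, List.mem_finRange, true_and] at hD
  obtain ⟨k, hk⟩ := hD
  refine ⟨k, ?_⟩
  rw [equationCNF] at hk
  rw [length_of_mem_canonicalCNF hk, length_eqVars, mul_one]

/-- An unsatisfiable CNF all of whose clauses are nonempty has a clause with a negative literal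
(otherwise the all-`true` assignment satisfies it). [folklore] -/
theorem exists_negative_literal {φ : CNF ℕ} (hφ : ¬ φ.Satisfiable) (hne : ∀ D ∈ φ, D ≠ []) :
    ∃ D ∈ φ, ∃ l ∈ D, l.2 = false := by
  by_contra h
  refine hφ ⟨fun _ => true, (CNF.eval_eq_true_iff φ _).2 fun D hD => ?_⟩
  obtain ⟨l, D', rfl⟩ := List.exists_cons_of_ne_nil (hne D hD)
  have hl : l.2 = true := by
    by_contra hl2
    exact h ⟨_, hD, l, List.mem_cons_self, by simpa using hl2⟩
  simp [Clause.eval, Literal.eval, hl]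

/-- **Under the route hypotheses the target has depth exactly `4`** (for `n ≥ 1`): boundary
expansion with radius `n^(1-δ) ≥ 1` and `c = 3ℓ/4 > 0` makes every support nonempty, so every
clause of `sumEncoding 1 E` is nonempty, and unsolvability gives an unsatisfiable CNF, hence a
negative literal. [Krajíček 2019, §13.3; Beck 2017, Def. 5.6] [folklore] -/
theorem altDepth_target_eq_four {ℓ n m : ℕ} {δ : ℝ} (hℓ : 1 ≤ ℓ) (hδ1 : δ < 1) (hn : 1 ≤ n)
    (E : Fin m → LinEqMod 2 n)
    (hexp : IsBoundaryExpander (fun i => (E i).supp.map Fin.valEmbedding) ((n : ℝ) ^ (1 - δ))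
      (3 / 4 * ℓ))
    (hunsat : ¬ SystemSat E Finset.univ) :
    (PropForm.neg (PropForm.ofCNF (sumEncoding 1 E))).altDepth = 4 := by
  refine le_antisymm ?_ ?_
  · -- `≤ 4` holds for every CNF (blocks `¬ / ∧ / ∨ / ¬`; = `altDepth_neg_ofCNF_le` of the calibration file)
    suffices h : altDepthAux 2 (PropForm.ofCNF (sumEncoding 1 E)) ≤ 2 by
      have := altDepthAux_le_altDepthAux_succ 1 2 (PropForm.ofCNF (sumEncoding 1 E))
      simp only [altDepth, altDepthAux, show (0 : ℕ) ≠ 1 from by decide, if_false]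
      omega
    generalize sumEncoding 1 E = φ
    induction φ with
    | nil => simp [PropForm.ofCNF]
    | cons c φ ih =>
      rw [ofCNF_cons]
      simp only [altDepthAux, if_true, add_zero, max_le_iff]
      refine ⟨?_, ih⟩
      suffices h : altDepthAux 3 (clauseForm c) ≤ 1 by
        have := altDepthAux_le_altDepthAux_succ 2 3 (clauseForm c); omega
      induction c with
      | nil => simp [clauseForm]
      | cons l c ihc =>
        rw [clauseForm_cons]
        simp only [altDepthAux, if_true, add_zero, max_le_iff]
        refine ⟨?_, ihc⟩
        unfold litForm
        split_ifs <;> simp [altDepthAux]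
  have hr : (1 : ℝ) ≤ (n : ℝ) ^ (1 - δ) :=
    Real.one_le_rpow (by exact_mod_cast hn) (by linarith)
  have hsupp : ∀ i, 0 < (E i).supp.card := fun i => by
    have := hexp.card_pos (by positivity) hr i
    rwa [Finset.card_map] at this
  have hunsatφ : ¬ (sumEncoding 1 E).Satisfiable := fun hsat =>
    hunsat ((sumEncoding_satisfiable_iff (p := 2) (B := 1) (by norm_num) (by norm_num) E).1 hsat)
  have hne : ∀ D ∈ sumEncoding 1 E, D ≠ [] := by
    intro D hD hnil
    obtain ⟨k, hk⟩ := exists_length_eq_of_mem_sumEncoding E hD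
    have := hsupp k
    rw [hnil, List.length_nil] at hk
    omega
  obtain ⟨D, hD, l, hl, hneg⟩ := exists_negative_literal hunsatφ hne
  exact four_le_altDepth_neg_ofCNF hD hl hneg

/-- **The slices `d ≤ 4` of the `AC⁰[p]` rung hold vacuously** (`stmt-PneNP-11444`): for
`d ≤ 4` the statement of `LinearGeneratorModPFregeHard` is true with `ε = 1`, `N = 1`, because
no depth-`d` `textbookFrege(MOD_p)` proof of the target exists at all — the target has
alternation depth `4` (`altDepth_target_eq_four`) and a proof of it contains a line of depth `5`
(`altDepth_succ_le_of_isModDepthProofOf_neg_ofCNF`).  The content of the rung therefore starts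
above depth `4` (and is certainly present from depth `30` on, see the calibration file).
[Buss et al. 1997, Def. 1.1; Krajíček 2019, Problem 15.6.1] [folklore] -/
theorem linearGeneratorModPFregeHard_of_depth_le_four :
    ∀ (p : ℕ), p.Prime → p ≠ 2 → ∀ (ℓ d : ℕ) (δ : ℝ), 1 ≤ ℓ → d ≤ 4 → 0 < δ → δ < 1 →
      ∃ ε : ℝ, 0 < ε ∧ ∃ N : ℕ, ∀ n : ℕ, N ≤ n → ∀ (m : ℕ) (E : Fin m → LinEqMod 2 n),
        (∀ i, (E i).supp.card ≤ ℓ) →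
        IsBoundaryExpander (fun i => (E i).supp.map Fin.valEmbedding) ((n : ℝ) ^ (1 - δ))
          (3 / 4 * ℓ) →
        ¬ SystemSat E Finset.univ →
        ∀ π : List (PropFormMod p ℕ), textbookFrege.IsModDepthProofOf d π
            (PropFormMod.ofPropForm (PropForm.neg (PropForm.ofCNF (sumEncoding 1 E)))) →
          (2 : ℝ) ^ ((n : ℝ) ^ ε) ≤ (modProofSize π : ℝ) := by
  intro p _ _ ℓ d δ hℓ hd _ hδ1
  refine ⟨1, one_pos, 1, fun n hn m E _ hexp hunsat π hπ => ?_⟩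
  exfalso
  have h1 := altDepth_succ_le_of_isModDepthProofOf_neg_ofCNF hπ
  rw [altDepth_target_eq_four hℓ hδ1 hn E hexp hunsat] at h1
  omega

end Summit.PneNP.PneNP.Theorems
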